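import Literature.Analysis.FluidPDE.ElgindiPolarH2Estimate
import HarnessLib

/-!
# The radial second-order estimate of the polar model operator and Proposition 7.1 assembled
([Elgindi2021] Proposition 7.1, a-priori form)

Topic `Literature/Analysis/FluidPDE`. Proof file (everything proved, no definitions, no named
facts) on the proof path of the named fact
`Literature.Analysis.FluidPDE.Elgindi.ElgindiGhoulMasmoudi2021_stabilityCore`
(`ElgindiStabilityDecomposition.lean`). T. M. Elgindi, Ann. of Math. 194 (2021) =
arXiv:1904.04795, §7.1 Proposition 7.1 (p. 19) and the last line of its proof (p. 20):

> "**Proposition 7.1.** … `|∂_θ(Ψ/cosθ)|_{L²} + |∂_θθΨ|_{L²} + α²|R²∂_RRΨ|_{L²} ≤ 100|F|_{L²}`."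
> … "The estimate on `α²|R²∂_RRf|_{L²}` follows easily."

For the a-priori class `Ψ = cosθ·χ`, `χ ∈ C³(ℝ²)` compactly supported with `χ(R,0) = 0`,
`F = L(Ψ)`, `∫₀^{π/2}F(R,·)K = 0` for `R > 0`, `0 < α ≤ 1`: the first energy identity also bounds
`α²‖R∂_RΨ‖² ≤ ⅓‖F‖²` and `‖χ‖² ≤ ⅔‖F‖²` (`integral_strip_sq_Rdz_le`), and then, by difference in
the equation, `α⁴‖R²∂_RRΨ‖² ≤ 130‖F‖²` (`integral_strip_sq_RRdzdz_le`). Together with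
`ElgindiPolarL2Estimate.lean` and `ElgindiPolarH2Estimate.lean` this is Proposition 7.1 in squared
a-priori form (`polar_apriori_estimate`: `‖∂_θ(Ψ/cosθ)‖² + ‖∂_θθΨ‖² + α⁴‖R²∂_RRΨ‖² ≤ 137‖F‖²`, so
each of the three printed norms is `≤ 12|F|`).
-/

noncomputable section

open MeasureTheory Set Real Filter Function intervalIntegral
open _root_.Topology

namespace Literature.Analysis.FluidPDE

namespace Elgindi

/-- `(a+b+c+d+e+f)² ≤ 6(a²+b²+c²+d²+e²+f²)`. [folklore] -/
theorem add_six_sq_le (a b c d e f : ℝ) :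
    (a + b + c + d + e + f) ^ 2 ≤ 6 * (a ^ 2 + b ^ 2 + c ^ 2 + d ^ 2 + e ^ 2 + f ^ 2) := by
  nlinarith [sq_nonneg (a - b), sq_nonneg (a - c), sq_nonneg (a - d), sq_nonneg (a - e), sq_nonneg (a - f),
    sq_nonneg (b - c), sq_nonneg (b - d), sq_nonneg (b - e), sq_nonneg (b - f), sq_nonneg (c - d),
    sq_nonneg (c - e), sq_nonneg (c - f), sq_nonneg (d - e), sq_nonneg (d - f), sq_nonneg (e - f)]

/-- The pointwise bound behind the radial estimate: with `c² ≤ 1`, `s² ≤ 1`, `0 ≤ α ≤ 1`,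
`(−g − α(5+α)d₁ − d₂ + cx + sq − 6y)² ≤ 6(g² + 36α²d₁² + d₂² + x² + q² + 36y²)`. [folklore] -/
theorem radial_pointwise_bound {α c s : ℝ} (hα0 : 0 ≤ α) (hα1 : α ≤ 1) (hc : c ^ 2 ≤ 1) (hs : s ^ 2 ≤ 1)
    (g d₁ d₂ x q y : ℝ) :
    (-g + -(α * (5 + α) * d₁) + -d₂ + c * x + s * q + -(6 * y)) ^ 2 ≤
      6 * (g ^ 2 + 36 * (α ^ 2 * d₁ ^ 2) + d₂ ^ 2 + x ^ 2 + q ^ 2 + 36 * y ^ 2) := by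
  refine (add_six_sq_le _ _ _ _ _ _).trans ?_
  have h5 : (5 + α) ^ 2 ≤ 36 := by nlinarith
  have t2 : (-(α * (5 + α) * d₁)) ^ 2 ≤ 36 * (α ^ 2 * d₁ ^ 2) := by
    have e : (-(α * (5 + α) * d₁)) ^ 2 = (5 + α) ^ 2 * (α ^ 2 * d₁ ^ 2) := by ring
    rw [e]
    exact mul_le_mul_of_nonneg_right h5 (by positivity)
  have t4 : (c * x) ^ 2 ≤ x ^ 2 := by
    rw [mul_pow]; exact mul_le_of_le_one_left (sq_nonneg _) hc
  have t5 : (s * q) ^ 2 ≤ q ^ 2 := by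
    rw [mul_pow]; exact mul_le_of_le_one_left (sq_nonneg _) hs
  have t1 : (-g) ^ 2 = g ^ 2 := by ring
  have t3 : (-d₂) ^ 2 = d₂ ^ 2 := by ring
  have t6 : (-(6 * y)) ^ 2 = 36 * y ^ 2 := by ring
  rw [t1, t3, t6]
  linarith

/-- **Proposition 7.1, a-priori form, all three second-order quantities**: for `Ψ = cosθ·χ`,
`χ ∈ C³(ℝ²)` compactly supported with `χ(R,0) = 0`, `0 < α ≤ 1`, and `F = L(Ψ)` orthogonal to
`K = 3sinθcos²θ` on every slice `R > 0`:
`α²‖R∂_RΨ‖² ≤ ⅓‖F‖²`, `‖Ψ/cosθ‖² ≤ ⅔‖F‖²`, and `α⁴‖R²∂_RRΨ‖² ≤ 130‖F‖²`; hence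
`‖∂_θ(Ψ/cosθ)‖² + ‖∂_θθΨ‖² + α⁴‖R²∂_RRΨ‖² ≤ 137‖F‖²` (norms in `L²(dRdθ)` of the strip). [cite: Elgindi2021, §7.1 Proposition 7.1 (p. 19 of arXiv:1904.04795) and the end of its proof (p. 20)] -/
theorem polar_apriori_estimate {α : ℝ} (hα : 0 < α) (hα1 : α ≤ 1) {χ : ℝ → ℝ → ℝ} (hχ : ContDiff ℝ 3 (uncurry χ))
    (hs : HasCompactSupport (uncurry χ)) (hχ0 : ∀ R, χ R 0 = 0) {Ψ : ℝ → ℝ → ℝ}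
    (hΨ : Ψ = fun R θ => Real.cos θ * χ R θ)
    (horth : ∀ R, 0 < R → ∫ θ in Ioo 0 (π / 2), ellipticOp α Ψ R θ * kernelK θ = 0) :
    α ^ 2 * (∫ p in strip, (p.1 * dz Ψ p.1 p.2) ^ 2) ≤ (1 / 3) * ∫ p in strip, ellipticOp α Ψ p.1 p.2 ^ 2 ∧
    (∫ p in strip, χ p.1 p.2 ^ 2) ≤ (2 / 3) * ∫ p in strip, ellipticOp α Ψ p.1 p.2 ^ 2 ∧
    α ^ 4 * (∫ p in strip, (p.1 ^ 2 * dz (dz Ψ) p.1 p.2) ^ 2) ≤ 130 * ∫ p in strip, ellipticOp α Ψ p.1 p.2 ^ 2 ∧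
    (∫ p in strip, dθ χ p.1 p.2 ^ 2) + (∫ p in strip, dθ (dθ Ψ) p.1 p.2 ^ 2) +
      α ^ 4 * (∫ p in strip, (p.1 ^ 2 * dz (dz Ψ) p.1 p.2) ^ 2) ≤ 137 * ∫ p in strip, ellipticOp α Ψ p.1 p.2 ^ 2 := by
  have hχ2 : ContDiff ℝ 2 (uncurry χ) := hχ.of_le (by norm_num)
  have hχ1 : ContDiff ℝ 1 (uncurry χ) := hχ.of_le (by norm_num)
  have hΨ3 : ContDiff ℝ 3 (uncurry Ψ) := by rw [hΨ]; exact contDiff_cosProfile hχ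
  have hΨ2 : ContDiff ℝ 2 (uncurry Ψ) := hΨ3.of_le (by norm_num)
  have hΨs : HasCompactSupport (uncurry Ψ) := by rw [hΨ]; exact hasCompactSupport_cosProfile hs
  have hdzΨ : ContDiff ℝ 2 (uncurry (dz Ψ)) := contDiff_dz_of_contDiff (n := 2) hΨ3
  have hdz2Ψ : ContDiff ℝ 1 (uncurry (dz (dz Ψ))) := contDiff_dz_of_contDiff (n := 1) hdzΨ
  have hdθΨ : ContDiff ℝ 2 (uncurry (dθ Ψ)) := contDiff_dθ_of_contDiff (n := 2) hΨ3
  have hdθ2Ψ : ContDiff ℝ 1 (uncurry (dθ (dθ Ψ))) := contDiff_dθ_of_contDiff (n := 1) hdθΨ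
  have hdθχ : ContDiff ℝ 2 (uncurry (dθ χ)) := contDiff_dθ_of_contDiff (n := 2) hχ
  have hdzΨs : HasCompactSupport (uncurry (dz Ψ)) := hasCompactSupport_dz hΨs
  have hdz2Ψs : HasCompactSupport (uncurry (dz (dz Ψ))) := hasCompactSupport_dz hdzΨs
  have hdθ2Ψs : HasCompactSupport (uncurry (dθ (dθ Ψ))) := hasCompactSupport_dθ_of (hasCompactSupport_dθ_of hΨs)
  have hdθχs : HasCompactSupport (uncurry (dθ χ)) := hasCompactSupport_dθ_of hs
  have cΨ : Continuous fun p : ℝ × ℝ => Ψ p.1 p.2 := hΨ3.continuous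
  have cχ : Continuous fun p : ℝ × ℝ => χ p.1 p.2 := hχ.continuous
  have cdz : Continuous fun p : ℝ × ℝ => dz Ψ p.1 p.2 := hdzΨ.continuous
  have cdz2 : Continuous fun p : ℝ × ℝ => dz (dz Ψ) p.1 p.2 := hdz2Ψ.continuous
  have cdθ : Continuous fun p : ℝ × ℝ => dθ Ψ p.1 p.2 := hdθΨ.continuous
  have cdθ2 : Continuous fun p : ℝ × ℝ => dθ (dθ Ψ) p.1 p.2 := hdθ2Ψ.continuous
  have cdθχ : Continuous fun p : ℝ × ℝ => dθ χ p.1 p.2 := hdθχ.continuous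
  -- previous results
  have hfirst := integral_strip_sq_dθ_le hα hα1 hχ2 hs hχ0 hΨ horth
  have hsecond := integral_strip_sq_dθdθ_le hα hα1 hχ hs hχ0 hΨ horth
  have hE := integral_strip_ellipticOp_mul_self α hχ2 hs hχ0 hΨ
  -- the continuous compactly supported representative of `L(Ψ)` on the strip
  set G : ℝ × ℝ → ℝ := fun p => -α ^ 2 * p.1 ^ 2 * dz (dz Ψ) p.1 p.2 - α * (5 + α) * p.1 * dz Ψ p.1 p.2 -
    dθ (dθ Ψ) p.1 p.2 + (Real.cos p.2 * χ p.1 p.2 + Real.sin p.2 * dθ χ p.1 p.2) - 6 * Ψ p.1 p.2 with hG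
  have cG : Continuous G := by simp only [hG]; fun_prop
  have hGeq : ∀ p ∈ strip, ellipticOp α Ψ p.1 p.2 = G p := by
    intro p hp
    have hcos : Real.cos p.2 ≠ 0 := (Real.cos_pos_of_mem_Ioo ⟨by linarith [hp.2.1, Real.pi_pos], hp.2.2⟩).ne'
    have hT : Real.cos p.2 * χ p.1 p.2 / Real.cos p.2 ^ 2 +
        Real.sin p.2 * (-Real.sin p.2 * χ p.1 p.2 + Real.cos p.2 * dθ χ p.1 p.2) / Real.cos p.2 =
        Real.cos p.2 * χ p.1 p.2 + Real.sin p.2 * dθ χ p.1 p.2 := by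
      rw [div_add_div _ _ (pow_ne_zero 2 hcos) hcos, div_eq_iff (mul_ne_zero (pow_ne_zero 2 hcos) hcos)]
      have := Real.sin_sq_add_cos_sq p.2
      linear_combination (-(Real.cos p.2 ^ 2 * χ p.1 p.2)) * this
    have hΨp : Ψ p.1 p.2 / Real.cos p.2 ^ 2 = Real.cos p.2 * χ p.1 p.2 / Real.cos p.2 ^ 2 := by rw [hΨ]
    have hdθp : dθ Ψ p.1 p.2 = -Real.sin p.2 * χ p.1 p.2 + Real.cos p.2 * dθ χ p.1 p.2 := by rw [hΨ, dθ_cosProfile hχ1]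
    have hud : DifferentiableAt ℝ (fun θ' => Ψ p.1 θ') p.2 :=
      ((hΨ2.comp (contDiff_const.prodMk contDiff_id)).differentiable (by simp)) p.2
    rw [ellipticOp_eq_expanded α hud hcos, hdθp, hΨp, hT]
  have hTΨ : tsupport (uncurry Ψ) ⊆ tsupport (uncurry χ) := by
    have e : uncurry Ψ = (fun p : ℝ × ℝ => Real.cos p.2) * uncurry χ := by rw [hΨ]; funext p; rfl
    rw [e]; exact tsupport_mul_subset_right
  have hGs : HasCompactSupport G := by
    refine HasCompactSupport.of_support_subset_isCompact hs.isCompact fun p hp => ?_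
    by_contra hT
    have h1 : χ p.1 p.2 = 0 := image_eq_zero_of_notMem_tsupport (f := uncurry χ) hT
    have h2 : Ψ p.1 p.2 = 0 := image_eq_zero_of_notMem_tsupport (f := uncurry Ψ) fun h => hT (hTΨ h)
    have h3 : dθ χ p.1 p.2 = 0 := image_eq_zero_of_notMem_tsupport (f := uncurry (dθ χ)) fun h => hT (tsupport_dθ_subset' χ h)
    have h4 : dz Ψ p.1 p.2 = 0 := image_eq_zero_of_notMem_tsupport (f := uncurry (dz Ψ)) fun h => hT (hTΨ (tsupport_dz_subset h))
    have h5 : dz (dz Ψ) p.1 p.2 = 0 := image_eq_zero_of_notMem_tsupport (f := uncurry (dz (dz Ψ))) fun h =>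
      hT (hTΨ (tsupport_dz_subset (tsupport_dz_subset h)))
    have h6 : dθ (dθ Ψ) p.1 p.2 = 0 := image_eq_zero_of_notMem_tsupport (f := uncurry (dθ (dθ Ψ))) fun h =>
      hT (hTΨ (tsupport_dθ_subset' Ψ (tsupport_dθ_subset' (dθ Ψ) h)))
    apply hp
    simp [hG, h1, h2, h3, h4, h5, h6]
  have sq_supp : ∀ (g : ℝ × ℝ → ℝ), HasCompactSupport g → HasCompactSupport fun p => g p ^ 2 := fun g hg => by
    have e : (fun p => g p ^ 2) = fun p => g p * g p := by funext p; ring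
    rw [e]; exact hg.mul_left
  have iG2 : Integrable fun p : ℝ × ℝ => G p ^ 2 := (cG.pow 2).integrable_of_hasCompactSupport (sq_supp G hGs)
  have sΨ : HasCompactSupport fun p : ℝ × ℝ => Ψ p.1 p.2 := hΨs
  have iE : Integrable fun p : ℝ × ℝ => Ψ p.1 p.2 ^ 2 := (cΨ.pow 2).integrable_of_hasCompactSupport (sq_supp _ sΨ)
  have iGΨ : Integrable fun p : ℝ × ℝ => G p * Ψ p.1 p.2 := (cG.mul cΨ).integrable_of_hasCompactSupport sΨ.mul_left
  have hCS := sq_integral_mul_le (μ := volume.restrict strip) iG2.integrableOn iE.integrableOn iGΨ.integrableOn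
  have eL : ∫ p in strip, ellipticOp α Ψ p.1 p.2 * Ψ p.1 p.2 = ∫ p in strip, G p * Ψ p.1 p.2 :=
    setIntegral_congr_fun measurableSet_strip fun p hp => by rw [hGeq p hp]
  have eL2 : ∫ p in strip, ellipticOp α Ψ p.1 p.2 ^ 2 = ∫ p in strip, G p ^ 2 :=
    setIntegral_congr_fun measurableSet_strip fun p hp => by rw [hGeq p hp]
  rw [eL2] at hfirst hsecond ⊢
  rw [eL] at hE
  have hL2nn : 0 ≤ ∫ p in strip, G p ^ 2 := integral_nonneg fun p => sq_nonneg _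
  have hXnn : 0 ≤ ∫ p in strip, Ψ p.1 p.2 ^ 2 := integral_nonneg fun p => sq_nonneg _
  have hYnn : 0 ≤ ∫ p in strip, dθ Ψ p.1 p.2 ^ 2 := integral_nonneg fun p => sq_nonneg _
  have hZnn : 0 ≤ ∫ p in strip, (p.1 * dz Ψ p.1 p.2) ^ 2 := integral_nonneg fun p => sq_nonneg _
  have hχnn : 0 ≤ ∫ p in strip, χ p.1 p.2 ^ 2 := integral_nonneg fun p => sq_nonneg _
  -- `⟨G,Ψ⟩ ≤ L2/6` from `X ≤ L2/36`
  have hXle := hfirst.2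
  have hIP : (∫ p in strip, G p * Ψ p.1 p.2) ≤ (1 / 6) * ∫ p in strip, G p ^ 2 := by
    by_contra hlt
    have hlt' := not_le.1 hlt
    have := hCS.trans (mul_le_mul_of_nonneg_left hXle hL2nn)
    nlinarith
  -- (i) `α² Z ≤ ⟨G,Ψ⟩ + 6X ≤ L2/6 + L2/6`; (ii) `½‖χ‖² ≤` the same
  have hc0 : 0 ≤ α * (5 + α) / 2 - α ^ 2 := by nlinarith
  have h2 : 0 ≤ (α * (5 + α) / 2 - α ^ 2) * ∫ p in strip, Ψ p.1 p.2 ^ 2 := mul_nonneg hc0 hXnn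
  have hRad : α ^ 2 * (∫ p in strip, (p.1 * dz Ψ p.1 p.2) ^ 2) ≤ (1 / 3) * ∫ p in strip, G p ^ 2 := by
    linarith [hE, h2, hYnn, hχnn, hIP, hXle]
  have hChi : (∫ p in strip, χ p.1 p.2 ^ 2) ≤ (2 / 3) * ∫ p in strip, G p ^ 2 := by
    have hαZ : 0 ≤ α ^ 2 * ∫ p in strip, (p.1 * dz Ψ p.1 p.2) ^ 2 := mul_nonneg (sq_nonneg _) hZnn
    linarith [hE, h2, hYnn, hIP, hXle]
  refine ⟨hRad, hChi, ?_⟩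
  -- (iii) the radial second-order term by difference
  have hP := hsecond.1
  have hQ := hsecond.2
  have hpt : ∀ p : ℝ × ℝ, (α ^ 2 * (p.1 ^ 2 * dz (dz Ψ) p.1 p.2)) ^ 2 ≤
      6 * (G p ^ 2 + 36 * (α ^ 2 * (p.1 * dz Ψ p.1 p.2) ^ 2) + dθ (dθ Ψ) p.1 p.2 ^ 2 + χ p.1 p.2 ^ 2 +
        dθ χ p.1 p.2 ^ 2 + 36 * Ψ p.1 p.2 ^ 2) := by
    intro p
    have e : α ^ 2 * (p.1 ^ 2 * dz (dz Ψ) p.1 p.2) = -G p + -(α * (5 + α) * (p.1 * dz Ψ p.1 p.2)) + -dθ (dθ Ψ) p.1 p.2 +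
        Real.cos p.2 * χ p.1 p.2 + Real.sin p.2 * dθ χ p.1 p.2 + -(6 * Ψ p.1 p.2) := by
      simp only [hG]; ring
    rw [e]
    exact radial_pointwise_bound hα.le hα1 (Real.cos_sq_le_one p.2) (Real.sin_sq_le_one p.2) _ _ _ _ _ _
  -- integrability of both sides
  have cL : Continuous fun p : ℝ × ℝ => (α ^ 2 * (p.1 ^ 2 * dz (dz Ψ) p.1 p.2)) ^ 2 := by fun_prop
  have sL : HasCompactSupport fun p : ℝ × ℝ => (α ^ 2 * (p.1 ^ 2 * dz (dz Ψ) p.1 p.2)) ^ 2 := by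
    have e : (fun p : ℝ × ℝ => (α ^ 2 * (p.1 ^ 2 * dz (dz Ψ) p.1 p.2)) ^ 2) =
        fun p : ℝ × ℝ => (α ^ 4 * p.1 ^ 4 * dz (dz Ψ) p.1 p.2) * dz (dz Ψ) p.1 p.2 := by funext p; ring
    rw [e]; exact (hdz2Ψs).mul_left
  have iL : Integrable fun p : ℝ × ℝ => (α ^ 2 * (p.1 ^ 2 * dz (dz Ψ) p.1 p.2)) ^ 2 := cL.integrable_of_hasCompactSupport sL
  have sZ : HasCompactSupport fun p : ℝ × ℝ => (p.1 * dz Ψ p.1 p.2) ^ 2 := by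
    have e : (fun p : ℝ × ℝ => (p.1 * dz Ψ p.1 p.2) ^ 2) = fun p : ℝ × ℝ => (p.1 * (p.1 * dz Ψ p.1 p.2)) * dz Ψ p.1 p.2 := by funext p; ring
    rw [e]; exact hdzΨs.mul_left
  have iZ : Integrable fun p : ℝ × ℝ => (p.1 * dz Ψ p.1 p.2) ^ 2 := (by fun_prop : Continuous fun p : ℝ × ℝ =>
    (p.1 * dz Ψ p.1 p.2) ^ 2).integrable_of_hasCompactSupport sZ
  have iP : Integrable fun p : ℝ × ℝ => dθ (dθ Ψ) p.1 p.2 ^ 2 := (cdθ2.pow 2).integrable_of_hasCompactSupport (sq_supp _ hdθ2Ψs)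
  have iχ : Integrable fun p : ℝ × ℝ => χ p.1 p.2 ^ 2 := (cχ.pow 2).integrable_of_hasCompactSupport (sq_supp _ hs)
  have iQ : Integrable fun p : ℝ × ℝ => dθ χ p.1 p.2 ^ 2 := (cdθχ.pow 2).integrable_of_hasCompactSupport (sq_supp _ hdθχs)
  have iR : Integrable fun p : ℝ × ℝ => 6 * (G p ^ 2 + 36 * (α ^ 2 * (p.1 * dz Ψ p.1 p.2) ^ 2) + dθ (dθ Ψ) p.1 p.2 ^ 2 +
      χ p.1 p.2 ^ 2 + dθ χ p.1 p.2 ^ 2 + 36 * Ψ p.1 p.2 ^ 2) :=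
    (((((iG2.add ((iZ.const_mul _).const_mul _)).add iP).add iχ).add iQ).add (iE.const_mul _)).const_mul _
  have hmono := setIntegral_mono_on (s := strip) iL.integrableOn iR.integrableOn measurableSet_strip fun p _ => hpt p
  -- evaluate the right-hand side by linearity
  have k1 : IntegrableOn (fun p : ℝ × ℝ => G p ^ 2 + 36 * (α ^ 2 * (p.1 * dz Ψ p.1 p.2) ^ 2)) strip :=
    (iG2.add ((iZ.const_mul _).const_mul _)).integrableOn
  have k2 : IntegrableOn (fun p : ℝ × ℝ => G p ^ 2 + 36 * (α ^ 2 * (p.1 * dz Ψ p.1 p.2) ^ 2) + dθ (dθ Ψ) p.1 p.2 ^ 2) strip :=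
    k1.add iP.integrableOn
  have k3 : IntegrableOn (fun p : ℝ × ℝ => G p ^ 2 + 36 * (α ^ 2 * (p.1 * dz Ψ p.1 p.2) ^ 2) + dθ (dθ Ψ) p.1 p.2 ^ 2 +
      χ p.1 p.2 ^ 2) strip := k2.add iχ.integrableOn
  have k4 : IntegrableOn (fun p : ℝ × ℝ => G p ^ 2 + 36 * (α ^ 2 * (p.1 * dz Ψ p.1 p.2) ^ 2) + dθ (dθ Ψ) p.1 p.2 ^ 2 +
      χ p.1 p.2 ^ 2 + dθ χ p.1 p.2 ^ 2) strip := k3.add iQ.integrableOn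
  have kZ : IntegrableOn (fun p : ℝ × ℝ => 36 * (α ^ 2 * (p.1 * dz Ψ p.1 p.2) ^ 2)) strip := ((iZ.const_mul _).const_mul _).integrableOn
  have kE : IntegrableOn (fun p : ℝ × ℝ => 36 * Ψ p.1 p.2 ^ 2) strip := (iE.const_mul _).integrableOn
  rw [MeasureTheory.integral_const_mul, integral_add k4 kE, integral_add k3 iQ.integrableOn, integral_add k2 iχ.integrableOn,
    integral_add k1 iP.integrableOn, integral_add iG2.integrableOn kZ, MeasureTheory.integral_const_mul,
    MeasureTheory.integral_const_mul, MeasureTheory.integral_const_mul] at hmono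
  have eLHS : ∫ p in strip, (α ^ 2 * (p.1 ^ 2 * dz (dz Ψ) p.1 p.2)) ^ 2 = α ^ 4 * ∫ p in strip, (p.1 ^ 2 * dz (dz Ψ) p.1 p.2) ^ 2 := by
    rw [← MeasureTheory.integral_const_mul]
    exact integral_congr_ae (ae_of_all _ fun p => by ring)
  rw [eLHS] at hmono
  have hRR : α ^ 4 * (∫ p in strip, (p.1 ^ 2 * dz (dz Ψ) p.1 p.2) ^ 2) ≤ 130 * ∫ p in strip, G p ^ 2 := by
    linarith [hmono, hRad, hP, hChi, hQ, hXle, hL2nn]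
  exact ⟨hRR, by linarith⟩

end Elgindi

end Literature.Analysis.FluidPDE
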